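import Summits.Ventures.PercRepro.S1TrianglePlusFreeA

/-!
# PercRepro — THE CONE LEMMA WITH THE PLANE BOUND (p1, gen 20; the first case of LEMMA T⁺⁺, (C1) + (C2))

Setting: (C1) (every rank-`2` set has `≤ 3` points), (C2) (every set of rank `≤ 3` has `≤ 6` points), `x` a
non-loop, `s` the set of ALL triangles through `x`, `U = {x} ∪ ⋃ s` the cone.

**`mem_of_mem_triangles_of_eRk_add_encard_le`** — if the cone carries all the nullity
(`r(U) + |E ∖ U| ≤ r(E)`, i.e. the points outside `U` are coloops), every triangle of `M` contains `x`.
Proof: a triangle `T` lies inside `U` (part A's coloop lemma); if `x ∉ T`, either (a) `T` contains both points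
`a, b` of a triangle `{x, a, b}` through `x` — then `x ∈ cl {a, b} ⊆ cl T` and `T ∪ {x}` is a 4-point set of
rank `2`, against (C1) — or (b) `T` meets every triangle through `x` in at most one point, so at least three
triangles through `x` meet `T`; they lie in `cl ({x} ∪ T)`, of rank `≤ 3`, and together with `x` they have
`≥ 7` points — against (C2). (Unlike T⁺'s cone lemma this needs no rank count of the cone.)
Axioms: standard.
-/

open scoped Matroid

namespace PercRepro

namespace S1

open Set

variable {α : Type}

/-- **THE CONE LEMMA WITH THE PLANE BOUND.** Under (C1) and (C2), if the cone `U` of the non-loop `x` carries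
all the nullity (`r(U) + |E ∖ U| ≤ r(E)`), every triangle of `M` contains `x`. -/
theorem mem_of_mem_triangles_of_eRk_add_encard_le (M : Matroid α) [M.Finite]
    (hC1 : ∀ L ⊆ M.E, M.eRk L = 2 → L.ncard ≤ 3) (hC2 : ∀ P ⊆ M.E, M.eRk P ≤ 3 → P.ncard ≤ 6)
    {x : α} (hx : M.IsNonloop x)
    (s : Finset (Set α)) (hmem : ∀ C, C ∈ s ↔ C ∈ ThmN.trianglesThrough M x)
    (hfull : M.eRk ({x} ∪ ⋃ C ∈ s, C) + (M.E \ ({x} ∪ ⋃ C ∈ s, C)).encard ≤ M.eRank)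
    {T : Set α} (hT : T ∈ ThmN.triangles M) : x ∈ T := by
  classical
  by_contra hxT
  have hs : ∀ C ∈ s, C ∈ ThmN.trianglesThrough M x := fun C hC => (hmem C).1 hC
  have hTE : T ⊆ M.E := hT.1.subset_ground
  have hTfin : T.Finite := M.ground_finite.subset hTE
  have hT3 : T.ncard = 3 := hT.2
  set U : Set α := {x} ∪ ⋃ C ∈ s, C with hU
  have hUE : U ⊆ M.E := by
    intro z hz
    rcases hz with hz | hz
    · rw [Set.mem_singleton_iff.1 hz]; exact hx.mem_ground
    · obtain ⟨C, hC, hzC⟩ := Set.mem_iUnion₂.1 hz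
      exact (hs C hC).1.subset_ground hzC
  -- `T ⊆ U`: the points outside the cone are coloops
  have hTU : T ⊆ U := IsCircuit.subset_of_eRk_add_encard_le M hUE hfull hT.1
  have hTs : ∀ w ∈ T, ∃ C ∈ s, w ∈ C := by
    intro w hw
    rcases hTU hw with h | h
    · exact absurd (Set.mem_singleton_iff.1 h ▸ hw) hxT
    · obtain ⟨C, hC, hwC⟩ := Set.mem_iUnion₂.1 h
      exact ⟨C, hC, hwC⟩
  -- case (a) — some triangle through `x` has both its other points in `T`
  by_cases hcaseA : ∃ C ∈ s, ∃ a ∈ T, ∃ b ∈ T, a ≠ b ∧ a ∈ C ∧ b ∈ C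
  · obtain ⟨C, hCs, a, haT, b, hbT, hab, haC, hbC⟩ := hcaseA
    have hC := hs C hCs
    have hCfin : C.Finite := M.ground_finite.subset hC.1.subset_ground
    have hax : a ≠ x := fun h => hxT (h ▸ haT)
    have hbx : b ≠ x := fun h => hxT (h ▸ hbT)
    have hCeq : C = {x, a, b} := by
      symm
      apply Set.eq_of_subset_of_ncard_le
      · intro w hw
        simp only [Set.mem_insert_iff, Set.mem_singleton_iff] at hw
        rcases hw with rfl | rfl | rfl
        · exact hC.2.2
        · exact haC
        · exact hbC
      · rw [hC.2.1]
        have h3 : ({x, a, b} : Set α).ncard = 3 := by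
          rw [Set.ncard_insert_of_notMem, Set.ncard_pair hab]
          simp only [Set.mem_insert_iff, Set.mem_singleton_iff, not_or]
          exact ⟨Ne.symm hax, Ne.symm hbx⟩
        rw [h3]
      · exact hCfin
    have hxcl : x ∈ M.closure T := by
      have h1 : x ∈ M.closure (C \ {x}) := hC.1.mem_closure_sdiff_singleton_of_mem hC.2.2
      have h2 : C \ {x} ⊆ T := by
        intro w hw
        rw [hCeq] at hw
        obtain ⟨hw1, hw2⟩ := hw
        simp only [Set.mem_insert_iff, Set.mem_singleton_iff] at hw1
        rcases hw1 with rfl | rfl | rfl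
        · exact absurd rfl hw2
        · exact haT
        · exact hbT
      exact M.closure_subset_closure h2 h1
    have hrT : M.eRk T = 2 := ThmN.eRk_eq_two_of_mem_trianglesThrough M ⟨hT.1, hT.2, haT⟩
    have hrTx : M.eRk (insert x T) = 2 := by
      apply le_antisymm
      · have hsub : insert x T ⊆ M.closure T :=
          Set.insert_subset hxcl (M.subset_closure T hTE)
        calc M.eRk (insert x T) ≤ M.eRk (M.closure T) := M.eRk_mono hsub
          _ = 2 := by rw [M.eRk_closure_eq, hrT]
      · rw [← hrT]; exact M.eRk_mono (Set.subset_insert x T)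
    have hTxE : insert x T ⊆ M.E := Set.insert_subset hx.mem_ground hTE
    have h4 : (insert x T).ncard = 4 := by
      rw [Set.ncard_insert_of_notMem hxT hTfin, hT3]
    have := hC1 (insert x T) hTxE hrTx
    omega
  -- case (b) — every triangle through `x` meets `T` in at most one point
  have hcaseB : ∀ C ∈ s, ∀ a ∈ T, ∀ b ∈ T, a ∈ C → b ∈ C → a = b := by
    intro C hC a ha b hb haC hbC
    by_contra hne
    exact hcaseA ⟨C, hC, a, ha, b, hb, hne, haC, hbC⟩
  set s' : Finset (Set α) := s.filter (fun C => ∃ w ∈ T, w ∈ C) with hs'def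
  have hs'sub : s' ⊆ s := Finset.filter_subset _ _
  have hs' : ∀ C ∈ s', C ∈ ThmN.trianglesThrough M x := fun C hC => hs C (hs'sub hC)
  have hchoice : ∀ w, w ∈ T → ∃ C, C ∈ s' ∧ w ∈ C := by
    intro w hw
    obtain ⟨C, hCs, hwC⟩ := hTs w hw
    exact ⟨C, Finset.mem_filter.2 ⟨hCs, w, hw, hwC⟩, hwC⟩
  have h3le : 3 ≤ s'.card := by
    let f : α → Set α := fun w => if h : w ∈ T then Classical.choose (hchoice w h) else ∅
    have hf : ∀ w ∈ T, f w ∈ (↑s' : Set (Set α)) := by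
      intro w hw
      simp only [f, dif_pos hw]
      exact Finset.mem_coe.2 (Classical.choose_spec (hchoice w hw)).1
    have hfw : ∀ w (hw : w ∈ T), w ∈ f w := by
      intro w hw
      simp only [f, dif_pos hw]
      exact (Classical.choose_spec (hchoice w hw)).2
    have hinj : Set.InjOn f T := by
      intro u hu v hv huv
      have hu' : u ∈ f u := hfw u hu
      have hv' : v ∈ f u := huv ▸ hfw v hv
      have hfs : f u ∈ s := hs'sub (Finset.mem_coe.1 (hf u hu))
      exact hcaseB (f u) hfs u hu v hv hu' hv'
    have := Set.ncard_le_ncard_of_injOn f hf hinj (Finset.finite_toSet s')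
    rw [hT3, Set.ncard_coe_finset] at this
    exact this
  -- the triangles through `x` meeting `T` lie in `cl ({x} ∪ T)`, of rank `≤ 3`
  set V : Set α := insert x T with hV
  have hVE : V ⊆ M.E := Set.insert_subset hx.mem_ground hTE
  have hrV : M.eRk V ≤ 3 := by
    have hrT : M.eRk T = 2 := by
      obtain ⟨w, hw⟩ := hT.1.nonempty
      exact ThmN.eRk_eq_two_of_mem_trianglesThrough M ⟨hT.1, hT.2, hw⟩
    calc M.eRk V ≤ M.eRk T + 1 := M.eRk_insert_le_add_one x T
      _ = 3 := by rw [hrT]; norm_num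
  have hs'cl : ∀ C ∈ s', C ⊆ M.closure V := by
    intro C hC
    obtain ⟨hCs, w, hwT, hwC⟩ := Finset.mem_filter.1 hC
    have hC' := hs C hCs
    have hwx : w ≠ x := fun h => hxT (h ▸ hwT)
    have hpair : ({x, w} : Set α) ⊆ V := by
      intro u hu
      simp only [Set.mem_insert_iff, Set.mem_singleton_iff] at hu
      rcases hu with rfl | rfl
      · exact Set.mem_insert u T
      · exact Set.mem_insert_of_mem x hwT
    have hpairC : ({x, w} : Set α) ⊆ C := by
      intro u hu
      simp only [Set.mem_insert_iff, Set.mem_singleton_iff] at hu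
      rcases hu with rfl | rfl
      · exact hC'.2.2
      · exact hwC
    have hCfin : C.Finite := M.ground_finite.subset hC'.1.subset_ground
    have hpair_ssub : ({x, w} : Set α) ⊂ C := by
      refine hpairC.ssubset_of_ne ?_
      intro h
      have := congrArg Set.ncard h
      rw [Set.ncard_pair (Ne.symm hwx), hC'.2.1] at this
      omega
    have hpair_indep : M.Indep ({x, w} : Set α) := hC'.1.ssubset_indep hpair_ssub
    have hpair_rk : M.eRk ({x, w} : Set α) = 2 := by
      rw [hpair_indep.eRk_eq_encard, Set.encard_pair (Ne.symm hwx)]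
    have hCcl : C ⊆ M.closure ({x, w} : Set α) :=
      ThmN.subset_closure_of_eRk_le M hpairC hC'.1.subset_ground hCfin
        (by rw [ThmN.eRk_eq_two_of_mem_trianglesThrough M hC', hpair_rk])
    exact hCcl.trans (M.closure_subset_closure hpair)
  -- the cone of `s'` has `1 + 2#s' ≥ 7` points and rank `≤ 3`: against (C2)
  set W : Set α := {x} ∪ ⋃ C ∈ s', C with hW
  have hWE : W ⊆ M.E := by
    intro z hz
    rcases hz with hz | hz
    · rw [Set.mem_singleton_iff.1 hz]; exact hx.mem_ground
    · obtain ⟨C, hC, hzC⟩ := Set.mem_iUnion₂.1 hz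
      exact (hs' C hC).1.subset_ground hzC
  have hWcl : W ⊆ M.closure V := by
    apply Set.union_subset
    · exact Set.singleton_subset_iff.2 (M.subset_closure V hVE (Set.mem_insert x T))
    · exact Set.iUnion₂_subset hs'cl
  have hrW : M.eRk W ≤ 3 := by
    calc M.eRk W ≤ M.eRk (M.closure V) := M.eRk_mono hWcl
      _ = M.eRk V := M.eRk_closure_eq V
      _ ≤ 3 := hrV
  have hcW : W.ncard = 1 + 2 * s'.card := (ThmN.eRk_le_and_ncard_eq_of_triangles M hC1 hx s' hs').2
  have := hC2 W hWE hrW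
  omega

end S1

end PercRepro
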